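import Summits.ABC.IUTFork.Repair.RHReqsideWeightLawsHeightScaling
import Summits.ABC.IUTFork.Repair.RHReqsideWeightLawsLabelOneCredit
import Summits.ABC.IUTFork.Repair.RHHeightScaling
import HarnessLib

/-!
# R-H ROUND 4, row R4OBJ-ARCH = R4-6 (iv) «HEIGHT-DEPENDENT ARCHIMEDEAN / INDETERMINACY SHARPENING c(h)» (census O-09) — THE KERNEL FACE,
# integer side + the exponent corollaries in the AXIS-D2 vocabulary: the price of the typed k1-cell is AFFINE in the indeterminacy multipliers,
# the demand is free of them ⇒ every bounded multiplier law keeps fraction exponent `−1`; only a LINEAR INFLATION of the radii is door-shaped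

abc-iut cell, rung LADDER-ABC:A2.RESCUE.H; seat abc-iut-rh2-w-1 (gen 5), KEY `wake/KEY-abc-iut-rh2-w-1-R4OBJ-ARCH.md` (abc-iut-rh-lead g5, 2026-08-27T13:46:57Z;
R4-TASKS.md §13; referee abc-iut-rh-ref-2). File of record `plan/rescue/R-H/ROUND4/R4-6-ARCH-rh2-w-1.md` (sha16 7e7e90cddaf2fad9) + per-datum `.tsv` 0aa25cfdebf27af1
(781 data, engine e2f3fbc8c6f4f1fb). PROOF-ONLY (0 definitions): vocabulary BY NAME from p506542 `RH.ReqsideWeightLaws` (`Cell`, `cell_iff_demand_le_price`,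
`cell_of_linear`, `linear_lt_of_cell`), p533167 `RH.ReqsideWeightLaws.HeightScaling` (`keptSlack_le_budget`, `den_mul_margin_eq`, `not_cell_sq_of_lt`,
`worked_print_extinct`), p532994 `RH.HeightScaling` (`ExponentAtMost`, `NegExponent`, `DoorAt`, `PriceBounded`), p531802 `RH.HeightScalingBarrier` (`PowerBoundFrom`)
and p534825 `RH.ReqsideWeightLaws.LabelOneCredit` (`not_powerBoundFrom_linear_of_lt_one`).

THE CLASS (REQB-SPEC §1 knob k3 made height-dependent; R4-TASKS §13): along the AXIS-D2 ray (places, `l`, `e_w`, `D_w`, `R_in`, `R_out` FIXED; `m_q ↦ s·m_q`)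
the three indeterminacy terms of the typed cell are scaled — Ind1 (different) `j·D ↦ j·c_D·D`, Ind2 (log-shell radii, jointly) `(j+1)·R_in, (j+1)·R_out ↦
(j+1)·c·R_in, (j+1)·c·R_out`, Ind3 = the lattice residue left at print (floor AFTER multiplication, REQB-SPEC §6 (b)). For RATIONAL multipliers `c_D = a_D/N`,
`c = a/N` the licence at `(w, j)` and order `m` IS p506542's k1-cell at the SCALED PLACE `Cell f den (N·e) (N·m) (a_D·δ) (a·r_in) (a·r_out) j` (p509351 /
p507493 homogeneity dictionary; the k3 rows of axes B/C are the constant points `(1,0)`, `(1,½)`, `(0,1)`).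
* §1 DICTIONARY: `cell_mult_iff` — ledger form `(f(j) − den)·N·m ≤ den·(a_D·(jδ) + a·((j+1)G)) + ρ`, `0 ≤ ρ < den·N·e`: the PRICE is AFFINE in `(a_D, a)`, the
  DEMAND free of them; floor-free sides `cell_mult_of_linear` / `linear_lt_of_cell_mult`; `cell_mult_mono_of_linear` (a floor-free licence survives any
  LARGER multipliers — a sharpening only removes licences, up to the residue); `kept_ge_min_demand_ind2` (the kept amount of a cell is at least
  `min(demand, den·a·(j+1)G)` — the floor the inflation member stands on).
* §2 THE ∀-CAP WITH MULTIPLIERS (instance of `keptSlack_le_budget` at the scaled place): `Σ_{j≤n} min(demand_j, price_j) ≤ den·(a_D·P_δ + a·P_G) + n·den·N·e`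
  with `P_δ = Σ_{j≤n} j·δ`, `P_G = Σ_{j≤n} (j+1)·G` (`keptSlack_mult_le`; closed forms `two_mul_sum_label(_succ)`: `2P_δ = n(n+1)δ`, `2P_G = n(n+3)G`); for a
  SHARPENING `0 ≤ a_D, a ≤ N` the cap is print's budget times `N` (`keptSlack_mult_le_print_budget`) — the kept FRACTION never exceeds print's `Π/M·s⁻¹`.
* §3 EXPONENTS (reals, p532994 vocabulary): a kept numerator capped by `c_D(s)·P_δ + c(s)·P_G + B` with `c_D, c ≤ 1` on `s ≥ 1` has `ExponentAtMost · (−1)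
  ((P_δ+P_G+B)/M₁)`, is `PriceBounded`, `NegExponent`, `¬DoorAt` (`exponentAtMost_neg_one_of_mult_cap`, `priceBounded_of_mult_cap`, `not_doorAt_of_mult_cap`) —
  NO decay rate and no bounded law changes the exponent; a multiplier growing like `κ·s^β` (`β ≥ 0`) gives exponent `≤ β − 1` (`exponentAtMost_of_mult_growth`:
  `√s ↦ −½`, `κ·s ↦ 0`); a numerator with a LINEAR FLOOR `s·K_∞ ≤ K(s)`, `K_∞ > 0` (the inflation member `c = κ·s`, via §1's floor) IS `DoorAt` with constant
  `K_∞/M₁` (`doorAt_of_linear_floor`) and obeys NO `PowerBoundFrom` of exponent `a < 1` from any onset (`not_powerBoundFrom_of_linear_floor`) — OUTSIDE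
  `Barrier`'s antecedent exactly like p534825's label-one credit: door-shaped because it is an inflation, not a sharpening.
* §4 WORKED PLACE FREY `p = 7`, `l = 107` (`e 1605`, `m_q 210`, `δ 1604`, `R_in 268`, `R_out −4472`, `G = 4740`, `l⋆ = 53`; FINAL (1)(b) integers): price pieces
  `P_δ = 2,295,324` (Ind1) and `P_G = 7,034,160` (Ind2; `P_δ + P_G = 9,329,484 = Π⁰` of p533167 `worked_priceSum`), residue cap `53·1605 = 85,065`, against
  `M₁ = 210·50,986 = 10,707,060`: ∀-caps at the five constant points `(1,1)` 9,414,549 (= p531802's envelope 0.8793·M₁) · `(1,½)` 11,794,938 at the doubled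
  place (= 0.5508·2M₁) · `(1,0)` 2,380,389 · `(0,1)` 7,119,225 · `(0,0)` 85,065 — for EVERY order; extinction of every label `≥ 2` past order `7949` at the
  doubled place for `c = ½` (= 18.93·m_q·2; print 6345 = 30.2·m_q, `worked_print_extinct`), `1605` for `(1,0)`, `5276` for `(0,1)`, `536` for `(0,0)`;
  INFLATION: `c = 3s` licenses EVERY label `1 … 53` at EVERY order multiple `s ≥ 1` (`κ = 3 > κ_lic = 52·210/4740 = 2.30`: the place closes), while `c = 2s`
  licenses the top label `53` at `s = 1` but at NO `s ≥ 2` (`κ = 2 < κ_lic`: DoorAt, non-closing).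
HONEST FRAMING: integer/real arithmetic about OUR typed cell under HYPOTHETICAL multiplier laws (REQB framing; [IUTchIV] Prop. 1.2/1.4 make the radii
theorems, not parameters — the axis-C word INCONSISTENT for `c ≠ 1` as a PRINT reading stands); «sharper archimedean estimates» in print ([IUTchIV] Thm. 1.10
Step (vii) `(l+5)/4·log π ≤ (l+1)/4·4`, Rmk. 2.3.2 (i)) live in the height-free tolerance, not in any cell price; nothing here asserts that abc is proved or
refuted, or that [IUTchIII] Cor. 3.12 / [IUTchIV] Thm. 1.10 holds or fails at any datum, or takes a side on any author; typed ≠ proved; computed ≠ proved.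
[claim: Mochizuki2012, status: disputed] for every IUT locution. [cite: Mochizuki2012, IUTchIV Prop. 1.2 p. 10, Prop. 1.4 p. 13, Thm. 1.10 Steps (v)–(viii)
p. 27–31, Rmk. 1.10.5 (ii) p. 34–35, Rmk. 2.2.1 (i) p. 48–49, Rmk. 2.3.2 (i) p. 56]
-/

namespace Summit.ABC.IUTFork.Repair.RH.ReqsideArchSharpening

open Finset
open Summit.ABC.IUTFork.Repair.RH.ReqsideWeightLaws
open Summit.ABC.IUTFork.Repair.RH.ReqsideWeightLaws.HeightScaling
open Summit.ABC.IUTFork.Repair.RH.HeightScaling (ExponentAtMost NegExponent DoorAt PriceBounded exponentAtMost_neg_one_of_le_const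
  negExponent_of_priceBounded not_doorAt_of_negExponent doorAt_of_const_le)
open Summit.ABC.IUTFork.Repair.RH.HeightScalingBarrier (PowerBoundFrom)
open Summit.ABC.IUTFork.Repair.RH.ReqsideWeightLaws.LabelOneCredit (not_powerBoundFrom_linear_of_lt_one)

/-! ## §1. Dictionary: the multiplier cell is the k1-cell at the scaled place; price affine in the multipliers -/

/-- **LEDGER FORM WITH MULTIPLIERS** (`den > 0`): at the scaled place `(N·e, N·m, a_D·δ, a·r_in, a·r_out)` — multipliers `c_D = a_D/N` on Ind1, `c = a/N` on
Ind2, order `m` (any height multiple) — `Cell ⟺ (f(j) − den)·(N·m) ≤ den·(a_D·(j·δ) + a·((j+1)·(r_in − r_out))) + ρ`, `ρ` the residue `mod den·N·e`: the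
price is AFFINE in `(a_D, a)`, the demand does not see them. [folklore] -/
theorem cell_mult_iff {den : ℤ} (hden : 0 < den) (f : ℕ → ℤ) (N aD a e m δ rin rout : ℤ) (j : ℕ) :
    Cell f den (N * e) (N * m) (aD * δ) (a * rin) (a * rout) j ↔
      (f j - den) * (N * m) ≤ den * (aD * ((j : ℤ) * δ) + a * (((j : ℤ) + 1) * (rin - rout)))
        + (f j * (N * m) - den * ((j : ℤ) * (aD * δ) + ((j : ℤ) + 1) * (a * rin))) % (den * (N * e)) := by
  have key : den * ((j : ℤ) * (aD * δ) + ((j : ℤ) + 1) * (a * rin - a * rout)) =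
      den * (aD * ((j : ℤ) * δ) + a * (((j : ℤ) + 1) * (rin - rout))) := by ring
  rw [cell_iff_demand_le_price hden, key]

/-- FLOOR-FREE SUFFICIENT SIDE with multipliers: `(f(j) − den)·N·m ≤ den·(a_D·(jδ) + a·((j+1)G)) ⟹ Cell` at the scaled place. [folklore] -/
theorem cell_mult_of_linear {den N e : ℤ} (hden : 0 < den) (hN : 0 < N) (he : 0 < e) {f : ℕ → ℤ} {aD a m δ rin rout : ℤ} {j : ℕ}
    (h : (f j - den) * (N * m) ≤ den * (aD * ((j : ℤ) * δ) + a * (((j : ℤ) + 1) * (rin - rout)))) :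
    Cell f den (N * e) (N * m) (aD * δ) (a * rin) (a * rout) j := by
  refine cell_of_linear hden (mul_pos hN he) ?_
  have key : den * ((j : ℤ) * (aD * δ) + ((j : ℤ) + 1) * (a * rin - a * rout)) =
      den * (aD * ((j : ℤ) * δ) + a * (((j : ℤ) + 1) * (rin - rout))) := by ring
  linarith

/-- FLOOR-FREE NECESSARY SIDE with multipliers: `Cell ⟹ (f(j) − den)·N·m < den·(a_D·(jδ) + a·((j+1)G)) + den·N·e`. [folklore] -/
theorem linear_lt_of_cell_mult {den N e : ℤ} (hden : 0 < den) (hN : 0 < N) (he : 0 < e) {f : ℕ → ℤ} {aD a m δ rin rout : ℤ} {j : ℕ}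
    (h : Cell f den (N * e) (N * m) (aD * δ) (a * rin) (a * rout) j) :
    (f j - den) * (N * m) < den * (aD * ((j : ℤ) * δ) + a * (((j : ℤ) + 1) * (rin - rout))) + den * (N * e) := by
  have h1 := linear_lt_of_cell hden (mul_pos hN he) h
  have key : den * ((j : ℤ) * (aD * δ) + ((j : ℤ) + 1) * (a * rin - a * rout)) =
      den * (aD * ((j : ℤ) * δ) + a * (((j : ℤ) + 1) * (rin - rout))) := by ring
  linarith

/-- **A SHARPENING ONLY REMOVES LICENCES (up to the residue)**: with `δ ≥ 0`, `G ≥ 0` a FLOOR-FREE licence at multipliers `(a_D, a)` survives at every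
`(a_D′, a′) ≥ (a_D, a)` — the price `den·(a_D·(jδ) + a·((j+1)G))` is monotone in both multipliers. [folklore] -/
theorem cell_mult_mono_of_linear {den N e : ℤ} (hden : 0 < den) (hN : 0 < N) (he : 0 < e) {f : ℕ → ℤ} {aD aD' a a' m δ rin rout : ℤ} {j : ℕ}
    (hδ : 0 ≤ δ) (hG : rout ≤ rin) (haD : aD ≤ aD') (ha : a ≤ a')
    (h : (f j - den) * (N * m) ≤ den * (aD * ((j : ℤ) * δ) + a * (((j : ℤ) + 1) * (rin - rout)))) :
    Cell f den (N * e) (N * m) (aD' * δ) (a' * rin) (a' * rout) j := by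
  refine cell_mult_of_linear hden hN he ?_
  have hj0 : (0 : ℤ) ≤ (j : ℤ) * δ := mul_nonneg (Nat.cast_nonneg j) hδ
  have hj1 : (0 : ℤ) ≤ ((j : ℤ) + 1) * (rin - rout) := mul_nonneg (by positivity) (sub_nonneg.mpr hG)
  have h1 : aD * ((j : ℤ) * δ) ≤ aD' * ((j : ℤ) * δ) := mul_le_mul_of_nonneg_right haD hj0
  have h2 : a * (((j : ℤ) + 1) * (rin - rout)) ≤ a' * (((j : ℤ) + 1) * (rin - rout)) := mul_le_mul_of_nonneg_right ha hj1
  have h3 : den * (aD * ((j : ℤ) * δ) + a * (((j : ℤ) + 1) * (rin - rout))) ≤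
      den * (aD' * ((j : ℤ) * δ) + a' * (((j : ℤ) + 1) * (rin - rout))) := mul_le_mul_of_nonneg_left (by linarith) hden.le
  linarith

/-- **THE FLOOR THE INFLATION MEMBER STANDS ON**: with `δ, a_D ≥ 0` the exact-slack kept amount of the cell, `min(demand, demand + den·margin) =
min(demand, price)`, is at least `min(demand, den·a·((j+1)G))` — the Ind2 part of the price alone (Ind1 and the residue are `≥ 0`). For `a = κ·s` and
demand `∝ s` both arguments are linear in `s`: the kept FRACTION has a positive height-free floor (§3 `doorAt_of_linear_floor`). [folklore] -/
theorem kept_ge_min_demand_ind2 {den N e : ℤ} (hden : 0 < den) (hN : 0 < N) (he : 0 < e) (f : ℕ → ℤ) {aD a m δ rin rout : ℤ} (j : ℕ)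
    (hδ : 0 ≤ δ) (haD : 0 ≤ aD) :
    min ((f j - den) * (N * m)) (den * (a * (((j : ℤ) + 1) * (rin - rout)))) ≤
      min ((f j - den) * (N * m)) ((f j - den) * (N * m) + den * (N * m - ((j : ℤ) + 1) * (a * rout) -
        N * e * ((f j * (N * m) - den * ((j : ℤ) * (aD * δ) + ((j : ℤ) + 1) * (a * rin))) / (den * (N * e))))) := by
  refine min_le_min le_rfl ?_
  rw [den_mul_margin_eq f den (N * e) (N * m) (aD * δ) (a * rin) (a * rout) j]
  have hρ := Int.emod_nonneg (f j * (N * m) - den * ((j : ℤ) * (aD * δ) + ((j : ℤ) + 1) * (a * rin))) (mul_pos hden (mul_pos hN he)).ne'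
  have hj0 : (0 : ℤ) ≤ den * ((j : ℤ) * (aD * δ)) := mul_nonneg hden.le (mul_nonneg (Nat.cast_nonneg j) (mul_nonneg haD hδ))
  have key : den * ((j : ℤ) * (aD * δ) + ((j : ℤ) + 1) * (a * rin - a * rout)) =
      den * ((j : ℤ) * (aD * δ)) + den * (a * (((j : ℤ) + 1) * (rin - rout))) := by ring
  linarith

/-! ## §2. The ∀-cap with multipliers: affine in `(a_D, a)`, for every order -/

/-- Closed form of the Ind1 label sum: `2·Σ_{j=1}^{n} j·δ = n(n+1)·δ`. [folklore] -/
theorem two_mul_sum_label (δ : ℤ) (n : ℕ) :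
    2 * ∑ i ∈ Finset.range n, (((i + 1 : ℕ) : ℤ)) * δ = (n : ℤ) * (n + 1) * δ := by
  induction n with
  | zero => simp
  | succ n ih => rw [Finset.sum_range_succ, mul_add, ih]; push_cast; ring

/-- Closed form of the Ind2 label sum: `2·Σ_{j=1}^{n} (j+1)·G = n(n+3)·G`. [folklore] -/
theorem two_mul_sum_label_succ (G : ℤ) (n : ℕ) :
    2 * ∑ i ∈ Finset.range n, ((((i + 1 : ℕ) : ℤ)) + 1) * G = (n : ℤ) * (n + 3) * G := by
  induction n with
  | zero => simp
  | succ n ih => rw [Finset.sum_range_succ, mul_add, ih]; push_cast; ring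

/-- **THE ∀-CAP WITH MULTIPLIERS** (p533167 `keptSlack_le_budget` at the scaled place, regrouped): for EVERY order `m` and EVERY law `f/den`, the place's
exact-slack kept amount in `den`-units obeys `Σ_{j≤n} min(demand_j, price_j) ≤ den·(a_D·Σ_j jδ + a·Σ_j (j+1)G) + n·den·N·e` — AFFINE in the multipliers,
free of `m`: divided by the demand unit `N·m·dS_f(n)` this is the class law `s·μ(s) ≤ den·[c_D·ĉ_δ + c·ĉ_G + ĉ_ρ]` of the file of record (§3). [folklore] -/
theorem keptSlack_mult_le {den N e : ℤ} (hden : 0 < den) (hN : 0 < N) (he : 0 < e) (f : ℕ → ℤ) (m δ rin rout aD a : ℤ) (n : ℕ) :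
    ∑ i ∈ Finset.range n, min ((f (i + 1) - den) * (N * m)) ((f (i + 1) - den) * (N * m) + den * (N * m - (((i + 1 : ℕ) : ℤ) + 1) * (a * rout) -
        N * e * ((f (i + 1) * (N * m) - den * ((((i + 1 : ℕ) : ℤ)) * (aD * δ) + (((i + 1 : ℕ) : ℤ) + 1) * (a * rin))) / (den * (N * e))))) ≤
      den * (aD * ∑ i ∈ Finset.range n, (((i + 1 : ℕ) : ℤ)) * δ + a * ∑ i ∈ Finset.range n, ((((i + 1 : ℕ) : ℤ)) + 1) * (rin - rout))
        + (n : ℤ) * (den * (N * e)) := by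
  have h := keptSlack_le_budget hden (mul_pos hN he) f (N * m) (aD * δ) (a * rin) (a * rout) n
  have key : ∑ i ∈ Finset.range n, ((((i + 1 : ℕ) : ℤ)) * (aD * δ) + (((i + 1 : ℕ) : ℤ) + 1) * (a * rin - a * rout)) =
      aD * ∑ i ∈ Finset.range n, (((i + 1 : ℕ) : ℤ)) * δ + a * ∑ i ∈ Finset.range n, ((((i + 1 : ℕ) : ℤ)) + 1) * (rin - rout) := by
    rw [Finset.mul_sum, Finset.mul_sum, ← Finset.sum_add_distrib]
    exact Finset.sum_congr rfl fun i _ => by ring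
  rw [key] at h
  exact h

/-- **A SHARPENING NEVER KEEPS MORE THAN PRINT'S BUDGET**: for `0 ≤ a_D ≤ N`, `0 ≤ a ≤ N` (multipliers `c_D, c ∈ [0, 1]`), `δ ≥ 0`, `G ≥ 0`, the cap is
`N·(den·(Σ_j jδ + Σ_j (j+1)G) + n·den·e)` — print's law-free budget per demand unit `N·m` (only the upper bounds `a_D, a ≤ N` are used): the kept FRACTION of every sharpening is `≤ Π/M·s⁻¹`, print's
constant, exponent `−1` (AXIS-D2 row 2 / BARRIER p531802 unchanged). [folklore] -/
theorem keptSlack_mult_le_print_budget {den N e : ℤ} (hden : 0 < den) (hN : 0 < N) (he : 0 < e) (f : ℕ → ℤ) (m : ℤ) {δ rin rout aD a : ℤ} (n : ℕ)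
    (hδ : 0 ≤ δ) (hG : rout ≤ rin) (haD : aD ≤ N) (ha : a ≤ N) :
    ∑ i ∈ Finset.range n, min ((f (i + 1) - den) * (N * m)) ((f (i + 1) - den) * (N * m) + den * (N * m - (((i + 1 : ℕ) : ℤ) + 1) * (a * rout) -
        N * e * ((f (i + 1) * (N * m) - den * ((((i + 1 : ℕ) : ℤ)) * (aD * δ) + (((i + 1 : ℕ) : ℤ) + 1) * (a * rin))) / (den * (N * e))))) ≤
      N * (den * (∑ i ∈ Finset.range n, (((i + 1 : ℕ) : ℤ)) * δ + ∑ i ∈ Finset.range n, ((((i + 1 : ℕ) : ℤ)) + 1) * (rin - rout))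
        + (n : ℤ) * (den * e)) := by
  have h := keptSlack_mult_le hden hN he f m δ rin rout aD a n
  have hSδ : 0 ≤ ∑ i ∈ Finset.range n, (((i + 1 : ℕ) : ℤ)) * δ :=
    Finset.sum_nonneg fun i _ => mul_nonneg (by positivity) hδ
  have hSG : 0 ≤ ∑ i ∈ Finset.range n, ((((i + 1 : ℕ) : ℤ)) + 1) * (rin - rout) :=
    Finset.sum_nonneg fun i _ => mul_nonneg (by positivity) (sub_nonneg.mpr hG)
  have h1 := mul_le_mul_of_nonneg_right haD hSδ
  have h2 := mul_le_mul_of_nonneg_right ha hSG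
  have h3 : den * (aD * ∑ i ∈ Finset.range n, (((i + 1 : ℕ) : ℤ)) * δ + a * ∑ i ∈ Finset.range n, ((((i + 1 : ℕ) : ℤ)) + 1) * (rin - rout)) ≤
      den * (N * ∑ i ∈ Finset.range n, (((i + 1 : ℕ) : ℤ)) * δ + N * ∑ i ∈ Finset.range n, ((((i + 1 : ℕ) : ℤ)) + 1) * (rin - rout)) :=
    mul_le_mul_of_nonneg_left (by linarith) hden.le
  have h4 : N * (den * (∑ i ∈ Finset.range n, (((i + 1 : ℕ) : ℤ)) * δ + ∑ i ∈ Finset.range n, ((((i + 1 : ℕ) : ℤ)) + 1) * (rin - rout))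
        + (n : ℤ) * (den * e)) =
      den * (N * ∑ i ∈ Finset.range n, (((i + 1 : ℕ) : ℤ)) * δ + N * ∑ i ∈ Finset.range n, ((((i + 1 : ℕ) : ℤ)) + 1) * (rin - rout))
        + (n : ℤ) * (den * (N * e)) := by ring
  linarith

/-! ## §3. Exponents along the ray (p532994 vocabulary): bounded multipliers `−1`; growth `β − 1`; a linear floor is door-shaped and outside the Barrier -/

/-- **NO BOUNDED MULTIPLIER LAW CHANGES THE EXPONENT.** If the kept numerator `K(s)` is capped by `c_D(s)·P_δ + c(s)·P_G + B` (§2 with weights `u_w ≥ 0`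
summed over places; `P_δ, P_G ≥ 0`) and the multipliers stay `≤ 1` on `s ≥ 1` — constant, decaying at ANY rate, or vanishing — then the kept fraction
`K(s)/(s·M₁)` has `ExponentAtMost · (−1) ((P_δ + P_G + B)/M₁)`: exponent `−1`, constant at most print's. [folklore] -/
theorem exponentAtMost_neg_one_of_mult_cap {K cD c : ℝ → ℝ} {Pδ PG B M₁ : ℝ} (hM : 0 < M₁) (hPδ : 0 ≤ Pδ) (hPG : 0 ≤ PG)
    (hcD : ∀ s : ℝ, 1 ≤ s → cD s ≤ 1) (hc : ∀ s : ℝ, 1 ≤ s → c s ≤ 1)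
    (hK : ∀ s : ℝ, 1 ≤ s → K s ≤ cD s * Pδ + c s * PG + B) :
    ExponentAtMost (fun s => K s / (s * M₁)) (-1) ((Pδ + PG + B) / M₁) := by
  refine exponentAtMost_neg_one_of_le_const hM fun s hs => ?_
  have h1 : cD s * Pδ ≤ Pδ := mul_le_of_le_one_left hPδ (hcD s hs)
  have h2 : c s * PG ≤ PG := mul_le_of_le_one_left hPG (hc s hs)
  linarith [hK s hs]

/-- … hence the profile is `PriceBounded M₁` in p532994's sense (certificate `K`, price `P_δ + P_G + B`). [folklore] -/
theorem priceBounded_of_mult_cap {K cD c : ℝ → ℝ} {Pδ PG B M₁ : ℝ} (hPδ : 0 ≤ Pδ) (hPG : 0 ≤ PG)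
    (hcD : ∀ s : ℝ, 1 ≤ s → cD s ≤ 1) (hc : ∀ s : ℝ, 1 ≤ s → c s ≤ 1)
    (hK : ∀ s : ℝ, 1 ≤ s → K s ≤ cD s * Pδ + c s * PG + B) :
    PriceBounded M₁ (fun s => K s / (s * M₁)) := by
  refine ⟨K, Pδ + PG + B, fun s hs => ?_, fun s _ => rfl⟩
  have h1 : cD s * Pδ ≤ Pδ := mul_le_of_le_one_left hPδ (hcD s hs)
  have h2 : c s * PG ≤ PG := mul_le_of_le_one_left hPG (hc s hs)
  linarith [hK s hs]

/-- **… hence `NegExponent` and NOT A DOOR**: the sharpening sub-class of R4-6 (iv) sits inside the price ceiling of p532994 `not_door_of_priceBounded` —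
«¬DoorAt» for every bounded multiplier law (the census row O-09 residual (a)). [folklore] -/
theorem not_doorAt_of_mult_cap {K cD c : ℝ → ℝ} {Pδ PG B M₁ : ℝ} (hM : 0 < M₁) (hPδ : 0 ≤ Pδ) (hPG : 0 ≤ PG)
    (hcD : ∀ s : ℝ, 1 ≤ s → cD s ≤ 1) (hc : ∀ s : ℝ, 1 ≤ s → c s ≤ 1)
    (hK : ∀ s : ℝ, 1 ≤ s → K s ≤ cD s * Pδ + c s * PG + B) :
    NegExponent (fun s => K s / (s * M₁)) ∧ ¬ DoorAt (fun s => K s / (s * M₁)) := by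
  have h := negExponent_of_priceBounded hM (priceBounded_of_mult_cap hPδ hPG hcD hc hK)
  exact ⟨h, not_doorAt_of_negExponent h⟩

/-- **GROWTH MOVES THE EXPONENT BY EXACTLY ITS OWN**: if the Ind2 multiplier grows at most like `κ·s^β` (`β ≥ 0`; Ind1 bounded) then the kept fraction
has `ExponentAtMost · (β − 1) ((P_δ + κ·P_G + B)/M₁)` — `β = ½ ↦ −½`, `β = 1 ↦ 0` (bed: −0.502 and 0.000 on 781/781 data). [folklore] -/
theorem exponentAtMost_of_mult_growth {K cD c : ℝ → ℝ} {Pδ PG B M₁ κ β : ℝ} (hM : 0 < M₁) (hPδ : 0 ≤ Pδ) (hPG : 0 ≤ PG) (hB : 0 ≤ B)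
    (hβ : 0 ≤ β) (hcD : ∀ s : ℝ, 1 ≤ s → cD s ≤ 1) (hc : ∀ s : ℝ, 1 ≤ s → c s ≤ κ * s ^ β)
    (hK : ∀ s : ℝ, 1 ≤ s → K s ≤ cD s * Pδ + c s * PG + B) :
    ExponentAtMost (fun s => K s / (s * M₁)) (β - 1) ((Pδ + κ * PG + B) / M₁) := by
  intro s hs
  have hs0 : 0 < s := by linarith
  have hsb : 1 ≤ s ^ β := Real.one_le_rpow hs hβ
  have h1 : cD s * Pδ ≤ Pδ := mul_le_of_le_one_left hPδ (hcD s hs)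
  have h2 : c s * PG ≤ κ * s ^ β * PG := mul_le_mul_of_nonneg_right (hc s hs) hPG
  have h3 : Pδ ≤ Pδ * s ^ β := le_mul_of_one_le_right hPδ hsb
  have h4 : B ≤ B * s ^ β := le_mul_of_one_le_right hB hsb
  have hK' : K s ≤ (Pδ + κ * PG + B) * s ^ β := by nlinarith [hK s hs]
  have h5 : K s / (s * M₁) ≤ (Pδ + κ * PG + B) * s ^ β / (s * M₁) := div_le_div_of_nonneg_right hK' (by positivity)
  have h6 : (Pδ + κ * PG + B) * s ^ β / (s * M₁) = (Pδ + κ * PG + B) / M₁ * s ^ (β - 1) := by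
    rw [Real.rpow_sub_one hs0.ne']
    field_simp
  simp only
  rw [← h6]
  exact h5

/-- **A LINEAR FLOOR IS A DOOR**: if the kept numerator dominates `s·K_∞` on `s ≥ 1` with `K_∞ > 0` (the inflation member `c = κ·s`: per cell `kept ≥
min(demand, den·κ·s·(j+1)G)`, both linear in `s`, §1 `kept_ge_min_demand_ind2`), the kept fraction stays `≥ K_∞/M₁ > 0` at every height: `DoorAt`
(bed: constant `μ_∞(κ)`, median 0.49 · 0.42 · 0.76 at `κ = 1` on FREY133 · HEX79 · FREY482). [folklore] -/
theorem doorAt_of_linear_floor {K : ℝ → ℝ} {Kinf M₁ : ℝ} (hM : 0 < M₁) (hKinf : 0 < Kinf) (hK : ∀ s : ℝ, 1 ≤ s → s * Kinf ≤ K s) :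
    DoorAt (fun s => K s / (s * M₁)) := by
  refine doorAt_of_const_le (c := Kinf / M₁) (div_pos hKinf hM) fun s hs => ?_
  have hs0 : 0 < s := by linarith
  rw [div_le_div_iff₀ hM (by positivity)]
  nlinarith [hK s hs]

/-- **… AND IT SITS OUTSIDE THE BARRIER**: a numerator with a positive linear floor obeys NO `PowerBoundFrom · a C s₁` with `a < 1`, from ANY onset — the
MASS exponent of the inflation member is `1`, outside `Barrier`'s antecedent (p531802) exactly like p534825's label-one credit; it is excluded correctly,
not missed: door-shaped because it INFLATES the radii linearly with the height, which is not a sharpening. [folklore] -/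
theorem not_powerBoundFrom_of_linear_floor {K : ℝ → ℝ} {Kinf a C s₁ : ℝ} (hKinf : 0 < Kinf) (ha : a < 1)
    (hK : ∀ s : ℝ, 1 ≤ s → s * Kinf ≤ K s) : ¬ PowerBoundFrom K a C s₁ := by
  intro h
  refine not_powerBoundFrom_linear_of_lt_one (c := Kinf) (C := C) (s₁ := max s₁ 1) hKinf ha fun s hs => ?_
  have hs1 : 1 ≤ s := le_trans (le_max_right _ _) hs
  calc Kinf * s = s * Kinf := mul_comm _ _
    _ ≤ K s := hK s hs1
    _ ≤ C * s ^ a := h s (le_trans (le_max_left _ _) hs)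

/-! ## §4. Worked place FREY `p = 7`, `l = 107`: `e = 1605`, `m_q = 210`, `δ = 1604`, `R_in = 268`, `R_out = −4472` (`G = 4740`), `l⋆ = 53` -/

/-- The two price pieces at the worked place: Ind1 `P_δ = Σ_{j≤53} j·1604 = 2,295,324` and Ind2 `P_G = Σ_{j≤53} (j+1)·4740 = 7,034,160` (sum
`9,329,484 = Π⁰` of p533167 `worked_priceSum`; Ind2 share `0.754`). [folklore] -/
theorem worked_pricePieces :
    ∑ i ∈ Finset.range 53, (((i + 1 : ℕ) : ℤ)) * (1604 : ℤ) = 2295324 ∧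
      ∑ i ∈ Finset.range 53, ((((i + 1 : ℕ) : ℤ)) + 1) * ((268 : ℤ) - (-4472)) = 7034160 := by
  have h1 := two_mul_sum_label (1604 : ℤ) 53
  have h2 := two_mul_sum_label_succ ((268 : ℤ) - (-4472)) 53
  simp only [Nat.cast_ofNat] at h1 h2
  constructor
  · linarith [h1]
  · linarith [h2]

/-- **∀-CAPS AT THE FIVE CONSTANT POINTS, EVERY ORDER `m`** (instances of `keptSlack_mult_le`; demand unit `N·m`, `M₁ = 210·50,986 = 10,707,060`):
`(N, a_D, a) = (1,1,1)` PRINT `≤ 9,414,549` (= the p531802 envelope, `0.8793·M₁`) · `(2,2,1)` = `c = ½` at the doubled place `≤ 11,794,938` (`0.5508·2M₁`) ·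
`(1,1,0)` = `c = 0` `≤ 2,380,389` (`0.2223·M₁`) · `(1,0,1)` = `c_D = 0` `≤ 7,119,225` (`0.6649·M₁`) · `(1,0,0)` residue only `≤ 85,065` (`0.0079·M₁`). [folklore] -/
theorem worked_caps (m : ℤ) :
    (∑ i ∈ Finset.range 53, min ((((i + 1 : ℕ) : ℤ) ^ 2 - 1) * (1 * m)) ((((i + 1 : ℕ) : ℤ) ^ 2 - 1) * (1 * m) + 1 * (1 * m - (((i + 1 : ℕ) : ℤ) + 1) * (1 * (-4472)) -
        1 * 1605 * (((((i + 1 : ℕ) : ℤ)) ^ 2 * (1 * m) - 1 * ((((i + 1 : ℕ) : ℤ)) * (1 * 1604) + (((i + 1 : ℕ) : ℤ) + 1) * (1 * 268))) / (1 * (1 * 1605))))) ≤ 9414549) ∧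
    (∑ i ∈ Finset.range 53, min ((((i + 1 : ℕ) : ℤ) ^ 2 - 1) * (2 * m)) ((((i + 1 : ℕ) : ℤ) ^ 2 - 1) * (2 * m) + 1 * (2 * m - (((i + 1 : ℕ) : ℤ) + 1) * (1 * (-4472)) -
        2 * 1605 * (((((i + 1 : ℕ) : ℤ)) ^ 2 * (2 * m) - 1 * ((((i + 1 : ℕ) : ℤ)) * (2 * 1604) + (((i + 1 : ℕ) : ℤ) + 1) * (1 * 268))) / (1 * (2 * 1605))))) ≤ 11794938) ∧
    (∑ i ∈ Finset.range 53, min ((((i + 1 : ℕ) : ℤ) ^ 2 - 1) * (1 * m)) ((((i + 1 : ℕ) : ℤ) ^ 2 - 1) * (1 * m) + 1 * (1 * m - (((i + 1 : ℕ) : ℤ) + 1) * (0 * (-4472)) -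
        1 * 1605 * (((((i + 1 : ℕ) : ℤ)) ^ 2 * (1 * m) - 1 * ((((i + 1 : ℕ) : ℤ)) * (1 * 1604) + (((i + 1 : ℕ) : ℤ) + 1) * (0 * 268))) / (1 * (1 * 1605))))) ≤ 2380389) ∧
    (∑ i ∈ Finset.range 53, min ((((i + 1 : ℕ) : ℤ) ^ 2 - 1) * (1 * m)) ((((i + 1 : ℕ) : ℤ) ^ 2 - 1) * (1 * m) + 1 * (1 * m - (((i + 1 : ℕ) : ℤ) + 1) * (1 * (-4472)) -
        1 * 1605 * (((((i + 1 : ℕ) : ℤ)) ^ 2 * (1 * m) - 1 * ((((i + 1 : ℕ) : ℤ)) * (0 * 1604) + (((i + 1 : ℕ) : ℤ) + 1) * (1 * 268))) / (1 * (1 * 1605))))) ≤ 7119225) ∧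
    (∑ i ∈ Finset.range 53, min ((((i + 1 : ℕ) : ℤ) ^ 2 - 1) * (1 * m)) ((((i + 1 : ℕ) : ℤ) ^ 2 - 1) * (1 * m) + 1 * (1 * m - (((i + 1 : ℕ) : ℤ) + 1) * (0 * (-4472)) -
        1 * 1605 * (((((i + 1 : ℕ) : ℤ)) ^ 2 * (1 * m) - 1 * ((((i + 1 : ℕ) : ℤ)) * (0 * 1604) + (((i + 1 : ℕ) : ℤ) + 1) * (0 * 268))) / (1 * (1 * 1605))))) ≤ 85065) := by
  obtain ⟨hP, hG⟩ := worked_pricePieces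
  have k111 := keptSlack_mult_le (den := 1) (N := 1) (e := 1605) one_pos one_pos (by norm_num) (fun j => (j : ℤ) ^ 2) m 1604 268 (-4472) 1 1 53
  have k221 := keptSlack_mult_le (den := 1) (N := 2) (e := 1605) one_pos two_pos (by norm_num) (fun j => (j : ℤ) ^ 2) m 1604 268 (-4472) 2 1 53
  have k110 := keptSlack_mult_le (den := 1) (N := 1) (e := 1605) one_pos one_pos (by norm_num) (fun j => (j : ℤ) ^ 2) m 1604 268 (-4472) 1 0 53
  have k101 := keptSlack_mult_le (den := 1) (N := 1) (e := 1605) one_pos one_pos (by norm_num) (fun j => (j : ℤ) ^ 2) m 1604 268 (-4472) 0 1 53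
  have k100 := keptSlack_mult_le (den := 1) (N := 1) (e := 1605) one_pos one_pos (by norm_num) (fun j => (j : ℤ) ^ 2) m 1604 268 (-4472) 0 0 53
  rw [hP, hG] at k111 k221 k110 k101 k100
  norm_num at k111 k221 k110 k101 k100 ⊢
  exact ⟨k111, k221, k110, k101, k100⟩

/-- **EXTINCTION ORDERS OF THE SHARPENINGS** (print law `j²`, slope `3`, p533167 `not_cell_sq_of_lt` at the scaled place; print itself: `worked_print_extinct`,
order `6345 = 30.2·m_q`): `c = ½` (doubled place `e 3210`, `δ 3208`, radii `×1`): no label `≥ 2` from order `7949` on (`= 18.93·(2m_q)`: the sharpening goes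
extinct at `0.63` of print's height); `c = 0`: from `1605 = 7.64·m_q`; `c_D = 0`: from `5276 = 25.1·m_q`; residue only: from `536 = 2.55·m_q`. [folklore] -/
theorem worked_sharpening_extinct {m : ℤ} {j : ℕ} (hj : 2 ≤ j) :
    (7949 ≤ m → ¬ Cell (fun j => (j : ℤ) ^ 2) 1 3210 m 3208 268 (-4472) j) ∧
    (1605 ≤ m → ¬ Cell (fun j => (j : ℤ) ^ 2) 1 1605 m 1604 0 0 j) ∧
    (5276 ≤ m → ¬ Cell (fun j => (j : ℤ) ^ 2) 1 1605 m 0 268 (-4472) j) ∧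
    (536 ≤ m → ¬ Cell (fun j => (j : ℤ) ^ 2) 1 1605 m 0 0 0 j) := by
  refine ⟨fun hm => ?_, fun hm => ?_, fun hm => ?_, fun hm => ?_⟩
  · exact not_cell_sq_of_lt (by norm_num) (by linarith) (by norm_num) (by norm_num) (by linarith) hj
  · exact not_cell_sq_of_lt (by norm_num) (by linarith) (by norm_num) le_rfl (by linarith) hj
  · exact not_cell_sq_of_lt (by norm_num) (by linarith) le_rfl (by norm_num) (by linarith) hj
  · exact not_cell_sq_of_lt (by norm_num) (by linarith) le_rfl le_rfl (by linarith) hj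

/-- **INFLATION `c = 3·s` CLOSES THE PLACE**: with the Ind2 radii multiplied by `3s` at order `s·m_q` (`κ = 3 > κ_lic = 52·210/4740 = 2.30`), EVERY label
`1 ≤ j ≤ 53` is licensed at EVERY height multiple `s ≥ 1` (`210s(j²−1) ≤ 14220s(j+1) + 1604j` since `210(j−1) ≤ 10920 ≤ 14220`). [folklore] -/
theorem worked_inflation_three_all {s : ℤ} (hs : 1 ≤ s) {j : ℕ} (hj : j ≤ 53) :
    Cell (fun j => (j : ℤ) ^ 2) 1 (1 * 1605) (1 * (s * 210)) (1 * 1604) ((3 * s) * 268) ((3 * s) * (-4472)) j := by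
  refine cell_mult_of_linear one_pos one_pos (by norm_num) ?_
  have hj' : (j : ℤ) ≤ 53 := by exact_mod_cast hj
  have hj0 : (0 : ℤ) ≤ j := Nat.cast_nonneg j
  have h1 : (210 : ℤ) * ((j : ℤ) - 1) ≤ 14220 := by linarith
  have h2 : (0 : ℤ) ≤ s * ((j : ℤ) + 1) := mul_nonneg (by linarith) (by linarith)
  have h3 := mul_le_mul_of_nonneg_right h1 h2
  nlinarith

/-- **INFLATION `c = 2·s` DOES NOT** (`κ = 2 < κ_lic`): the top label `53` is licensed at `s = 1` (`589,680 ≤ 85,012 + 511,920`) but at NO height multiple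
`s ≥ 2` (`589,680·s < 86,617 + 511,920·s` fails) — the member is `DoorAt`, NON-closing at this place: a door needs every cell, i.e. `κ ≥ κ_lic`. [folklore] -/
theorem worked_inflation_two_top :
    Cell (fun j => (j : ℤ) ^ 2) 1 (1 * 1605) (1 * (1 * 210)) (1 * 1604) ((2 * 1) * 268) ((2 * 1) * (-4472)) 53 ∧
      ∀ s : ℤ, 2 ≤ s → ¬ Cell (fun j => (j : ℤ) ^ 2) 1 (1 * 1605) (1 * (s * 210)) (1 * 1604) ((2 * s) * 268) ((2 * s) * (-4472)) 53 := by
  refine ⟨cell_mult_of_linear one_pos one_pos (by norm_num) (by norm_num), fun s hs h => ?_⟩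
  have h1 := linear_lt_of_cell_mult one_pos one_pos (by norm_num : (0 : ℤ) < 1605) h
  push_cast at h1
  nlinarith

end Summit.ABC.IUTFork.Repair.RH.ReqsideArchSharpening
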